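import Mathlib
import HarnessLib.Audit
import Summits.PneNP.PneNP.Theorems.PstarUnionCaseB
import Summits.PneNP.PneNP.Theorems.PstarUnionChordPair

/-!
# Case B, node B-I: if `w₂` reads one chord literal it reads a literal of every chord (ROUND-24, memo §14.21 B-I; typed sketch `r24/SketchCaseB.lean`)

FRONTIER range-avoidance ladder, rung F-N3, ROUND 24 (cell `pnp-ideate`, planner memo `r24/CORE-BOUND-NOTES.md` §14.21, typed node `chords_read_of_one` of planner p3 g22's
`r24/SketchCaseB.lean`, statement VERBATIM up to spelling out `Reads`; restricted-model proof complexity — nothing here bears on `P` versus `NP`).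

* `eval_reset_iff` — resetting an ON private pair to `(0,0)` flips the chord;
* `chords_read_of_one` — **B-I**: union-terminal core, admissible `F`, hun; if `w₂` reads a literal of the chord `c` then it reads a literal of every chord `c'`.
  Proof (p3's plan): a chord `c'` unread by `w₂` is read linearly by `A₀` or `A₁` (B6 `PstarUnionCaseB.read_by_someone`), hence HARD on `Z` (A2
  `PstarUnionAtoms.hard_of_pinned_read`: its privates are `1` on all of `Z`); CORE `PstarUnionChordPair.chordPair_surjective (false, false)` gives a solution of
  `J₀ − c − c'` violating both chords with privates `1`; resetting the pair of `c'` to `(0,0)` solves `c'` and keeps everything else, and B7 `PstarUnionCaseB.exists_Z_of_sheet`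
  on `c` then lands in `Z` with `a_{c'} = 0` — contradiction.
-/

set_option linter.dupNamespace false -- `Summit.PneNP.PneNP.…`: summit = sub-problem name (D-0017 single-conjunct layout)

open Finset Literature.Computability.Complexity
open Summit.PneNP.PneNP.Theorems.PstarFibrePolys (bit bit_injective)
open Summit.PneNP.PneNP.Theorems.PstarTyped (Typed)
open Summit.PneNP.PneNP.Theorems.PstarSALevel (varSet bdry BoundaryExpanding SimpleOverlap)
open Summit.PneNP.PneNP.Theorems.PstarGapPeeling (not_mem_varSet_of_private eval_pure)
open Summit.PneNP.PneNP.Theorems.PstarCentreFree (vars_mem_varSet)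
open Summit.PneNP.PneNP.Theorems.PstarGapOneAll (gval)
open Summit.PneNP.PneNP.Theorems.PstarCoreBound (XorClosed)
open Summit.PneNP.PneNP.Theorems.PstarChordRepair (IsChord)
open Summit.PneNP.PneNP.Theorems.PstarChordBridgeCotree (Peelable)
open Summit.PneNP.PneNP.Theorems.PstarChordBridgeTools (privs mem_privs)
open Summit.PneNP.PneNP.Theorems.PstarUnion (SatPair UnionTerminal)
open Summit.PneNP.PneNP.Theorems.PstarUnionAtoms (Untouched hard_of_pinned_read)
open Summit.PneNP.PneNP.Theorems.PstarUnionCaseB (read_by_someone setPair_two setPair_of_ne eval_setPair_of_ne exists_Z_of_sheet)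
open Summit.PneNP.PneNP.Theorems.PstarUnionChordPair (chordPair_surjective)

namespace Summit.PneNP.PneNP.Theorems.PstarUnionCaseBReads

variable {n m : ℕ}

/-- **Resetting an ON private pair flips the chord**: with `a_c = b_c = 1` at `x`, the `(0,0)`-reset satisfies `c` iff `x` violates it. -/
theorem eval_reset_iff (I : LocalMap 4 n m) (hI : I.IsPure xorAndPred) (c : Fin m) (x : Fin n → Bool) (h2 : x (I.vars c 2) = true)
    (h3 : x (I.vars c 3) = true) (t : Bool) :
    I.eval (Function.update (Function.update x (I.vars c 2) false) (I.vars c 3) false) c = t ↔ I.eval x c ≠ t := by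
  have hinj := hI.2 c
  have h02 : I.vars c 0 ≠ I.vars c 2 := fun h => absurd (hinj h) (by decide)
  have h03 : I.vars c 0 ≠ I.vars c 3 := fun h => absurd (hinj h) (by decide)
  have h12 : I.vars c 1 ≠ I.vars c 2 := fun h => absurd (hinj h) (by decide)
  have h13 : I.vars c 1 ≠ I.vars c 3 := fun h => absurd (hinj h) (by decide)
  rw [eval_pure I hI, eval_pure I hI, (setPair_two I hI c x false false).1, (setPair_two I hI c x false false).2,
    setPair_of_ne I c x false false h02 h03, setPair_of_ne I c x false false h12 h13, h2, h3]
  cases x (I.vars c 0) <;> cases x (I.vars c 1) <;> cases t <;> decide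

/-- **B-I.**  In a union-terminal configuration with admissible `F` and hun, if `w₂` reads a literal of one chord then it reads a literal of every chord. -/
theorem chords_read_of_one (I : LocalMap 4 n m) (hI : I.IsPure xorAndPred) (hT : Typed I) (hS : SimpleOverlap I) {r : ℕ} (hE : BoundaryExpanding r I)
    {y : Fin m → Bool} {J₀ : Finset (Fin m)} {A₀ A₁ w₂ : Finset (Fin n) × Finset (Fin m) × Bool} (hU : UnionTerminal I r y J₀ A₀ A₁ w₂)
    {F : Finset (Fin m)} (hF : F ⊆ J₀) (hP : Peelable I F) (hmax : ∀ F', F ⊆ F' → F' ⊆ J₀ → Peelable I F' → F' = F)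
    (hchord : ∀ e ∈ J₀ \ F, IsChord I J₀ e) (hun : ∀ g ∈ A₀.2.1 ∪ w₂.2.1, ∀ v ∈ privs I (J₀ \ F), I.vars g 2 ≠ v ∧ I.vars g 3 ≠ v)
    {c : Fin m} (hc : c ∈ J₀ \ F) (hread : I.vars c 2 ∈ w₂.1 ∨ I.vars c 3 ∈ w₂.1) :
    ∀ c' ∈ J₀ \ F, I.vars c' 2 ∈ w₂.1 ∨ I.vars c' 3 ∈ w₂.1 := by
  classical
  obtain ⟨-, hX, hJr, hG, -, -, -, -, hn₀, hn₁, hcov⟩ := hU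
  intro c' hc'
  by_contra hnot
  rw [not_or] at hnot
  have hcc' : c ≠ c' := fun e => by rw [e] at hread; exact hread.elim hnot.1 hnot.2
  have hcJ : c ∈ J₀ := (mem_sdiff.1 hc).1
  have hc'J : c' ∈ J₀ := (mem_sdiff.1 hc').1
  have hchc := hchord c hc
  have hchc' := hchord c' hc'
  -- gate-freeness from hun
  have gf : ∀ A : Finset (Fin n) × Finset (Fin m) × Bool, A.2.1 ⊆ A₀.2.1 ∪ w₂.2.1 → ∀ e ∈ J₀ \ F,
      ∀ g ∈ A.2.1, I.vars g 2 ≠ I.vars e 2 ∧ I.vars g 3 ≠ I.vars e 2 ∧ I.vars g 2 ≠ I.vars e 3 ∧ I.vars g 3 ≠ I.vars e 3 := by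
    intro A hA e he g hg
    have h2 := hun g (hA hg) _ ((mem_privs I).2 ⟨e, he, Or.inl rfl⟩)
    have h3 := hun g (hA hg) _ ((mem_privs I).2 ⟨e, he, Or.inr rfl⟩)
    exact ⟨h2.1, h2.2, h3.1, h3.2⟩
  have gf₀ := gf A₀ subset_union_left
  have gf₁ : ∀ e ∈ J₀ \ F, ∀ g ∈ A₁.2.1, I.vars g 2 ≠ I.vars e 2 ∧ I.vars g 3 ≠ I.vars e 2 ∧ I.vars g 2 ≠ I.vars e 3 ∧ I.vars g 3 ≠ I.vars e 3 := by
    rw [hG]; exact gf₀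
  have gf₂ := gf w₂ subset_union_right
  -- `w₂` is untouched on the privates of `c'`
  have hw : Untouched I w₂ (I.vars c' 2) ∧ Untouched I w₂ (I.vars c' 3) :=
    ⟨⟨hnot.1, fun g hg => ⟨(gf₂ c' hc' g hg).1, (gf₂ c' hc' g hg).2.1⟩⟩, ⟨hnot.2, fun g hg => ⟨(gf₂ c' hc' g hg).2.2.1, (gf₂ c' hc' g hg).2.2.2⟩⟩⟩
  -- some reader reads `c'` (linearly)
  have hreads : (I.vars c' 2 ∈ A₀.1 ∨ I.vars c' 3 ∈ A₀.1) ∨ (I.vars c' 2 ∈ A₁.1 ∨ I.vars c' 3 ∈ A₁.1) := by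
    by_contra h
    simp only [not_or] at h
    exact read_by_someone I hI hn₀ hn₁ hcov hc'J hchc' hw
      ⟨⟨h.1.1, fun g hg => ⟨(gf₀ c' hc' g hg).1, (gf₀ c' hc' g hg).2.1⟩⟩, ⟨h.1.2, fun g hg => ⟨(gf₀ c' hc' g hg).2.2.1, (gf₀ c' hc' g hg).2.2.2⟩⟩⟩
      ⟨⟨h.2.1, fun g hg => ⟨(gf₁ c' hc' g hg).1, (gf₁ c' hc' g hg).2.1⟩⟩, ⟨h.2.2, fun g hg => ⟨(gf₁ c' hc' g hg).2.2.1, (gf₁ c' hc' g hg).2.2.2⟩⟩⟩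
  -- a pinned reader: both `Aᵢ` are constant on `Z` (T3)
  have pin : ∀ A : Finset (Fin n) × Finset (Fin m) × Bool, ¬ SatPair I y J₀ A w₂ →
      ∀ x x' : Fin n → Bool, (∀ j ∈ J₀, I.eval x j = y j) → gval I w₂.1 w₂.2.1 x = w₂.2.2 →
        (∀ j ∈ J₀, I.eval x' j = y j) → gval I w₂.1 w₂.2.1 x' = w₂.2.2 → gval I A.1 A.2.1 x = gval I A.1 A.2.1 x' := by
    intro A hn x x' hx hxw hx' hx'w
    have e : ∀ a b t : Bool, a ≠ t → b ≠ t → a = b := by decide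
    exact e _ _ A.2.2 (fun h => hn ⟨x, hx, h, hxw⟩) (fun h => hn ⟨x', hx', h, hx'w⟩)
  -- hardness of `c'` on `Z`
  have hard : ∀ x : Fin n → Bool, (∀ j ∈ J₀, I.eval x j = y j) → gval I w₂.1 w₂.2.1 x = w₂.2.2 →
      x (I.vars c' 2) = true ∧ x (I.vars c' 3) = true := by
    intro x hx hxw
    rcases hreads with h | h
    · exact hard_of_pinned_read I hI hc'J hchc' w₂ A₀ hw (gf₀ c' hc') h (pin A₀ hn₀) hx hxw
    · exact hard_of_pinned_read I hI hc'J hchc' w₂ A₁ hw (gf₁ c' hc') h (pin A₁ hn₁) hx hxw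
  -- CORE: violate both chords with privates ON
  obtain ⟨x, hxJ, h2, h3, h2', h3', hcx, hc'x⟩ := chordPair_surjective I hI hT hS hE hX hJr hF hP hmax hchord hc hc' hcc' false false
  have hvc : I.eval x c ≠ y c := fun h => Bool.false_ne_true (hcx.1 h)
  have hvc' : I.eval x c' ≠ y c' := fun h => Bool.false_ne_true (hc'x.1 h)
  -- the privates of `c` and `c'` are distinct variables
  have cross : ∀ s : Fin 4, I.vars c' s ≠ I.vars c 2 ∧ I.vars c' s ≠ I.vars c 3 := by
    intro s
    constructor
    · intro h
      exact not_mem_varSet_of_private I hcJ hc'J hcc'.symm hchc.1 (vars_mem_varSet I c 2) (h ▸ vars_mem_varSet I c' s)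
    · intro h
      exact not_mem_varSet_of_private I hcJ hc'J hcc'.symm hchc.2 (vars_mem_varSet I c 3) (h ▸ vars_mem_varSet I c' s)
  -- reset the pair of `c'` to `(0,0)`
  set x' : Fin n → Bool := Function.update (Function.update x (I.vars c' 2) false) (I.vars c' 3) false with hx'
  have hx'J : ∀ j ∈ J₀, j ≠ c → I.eval x' j = y j := by
    intro j hj hjc
    by_cases hjc' : j = c'
    · subst hjc'
      exact (eval_reset_iff I hI j x h2' h3' (y j)).2 hvc'
    · rw [hx', eval_setPair_of_ne I hc'J hchc' x false false hj hjc']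
      exact hxJ j hj hjc hjc'
  have hx'c2 : x' (I.vars c 2) = true := by rw [hx', setPair_of_ne I c' x false false (cross 2).1.symm (cross 3).1.symm]; exact h2
  have hx'c3 : x' (I.vars c 3) = true := by rw [hx', setPair_of_ne I c' x false false (cross 2).2.symm (cross 3).2.symm]; exact h3
  have h0 : I.eval (Function.update (Function.update x' (I.vars c 2) false) (I.vars c 3) false) c = y c := by
    refine (eval_reset_iff I hI c x' hx'c2 hx'c3 (y c)).2 ?_
    rw [hx', eval_setPair_of_ne I hc'J hchc' x false false hcJ hcc']
    exact hvc
  -- B7 on `c` lands in `Z` with `a_{c'} = 0`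
  obtain ⟨a, b, -, hsol, hw₂⟩ := exists_Z_of_sheet I hI hcJ hchc w₂ (gf₂ c hc) hread hx'J h0
  have hon := (hard _ hsol hw₂).1
  rw [setPair_of_ne I c x' a b (cross 2).1 (cross 2).2, hx'] at hon
  have h23 : I.vars c' 2 ≠ I.vars c' 3 := fun h => absurd (hI.2 c' h) (by decide)
  rw [Function.update_of_ne h23, Function.update_self] at hon
  exact Bool.false_ne_true hon

end Summit.PneNP.PneNP.Theorems.PstarUnionCaseBReads
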